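import Mathlib
import HarnessLib

/-!
# NE7SpectralResolution — THE CALCULUS OF AN ORTHOGONAL RESOLUTION AND THE SPECTRAL PROJECTIONS OF A SELF-ADJOINT MATRIX VIA THE CONTINUOUS FUNCTIONAL CALCULUS
# (file S3b-2a of the `k`-uniform stabiliser lifting programme: the algebra behind (ACU))

Cell `pub-balaban`, rung (B)+1 sub-cell t4, lineage `b2b-balaban-t4-ne7b-p1` (row NE7b OWNER + CRUX PROVER; junction service for row NE7, ruling R-OWNER-149-1 (2)),
generation 159.  Memo `t4/b2b-balaban-t4-ne7b-p1/g159/records/S3-BRIEF.md` §2 (b).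
WHAT ([folklore]; 0 def, 0 sorry; complex `n × n` matrices, `L²`-operator norm, Mathlib's real CFC for `IsSelfAdjoint`).
§1 THE CALCULUS OF AN ORTHOGONAL RESOLUTION: if `P_j` (`j` in a finite type) are pairwise orthogonal idempotents with `Σ P_j = 1` and `h = Σ k_j P_j` (`k_j ∈ ℝ`) is self-adjoint,
then the real spectrum of `h` is `{k_j : P_j ≠ 0}` (`spectrum_subset_of_resolution`, `mem_spectrum_of_resolution`) and **`cfc_eq_sum_of_resolution`**: `cfc f h = Σ_j f(k_j) P_j`
for EVERY `f` (powers, polynomials by induction, then Lagrange interpolation on the finite spectrum + `cfc_congr` + `cfc_polynomial`).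
§2 SPECTRAL PROJECTIONS `E_k(h) = cfc 𝟙_{{k}} h` of a self-adjoint matrix: pairwise orthogonal idempotents (`specProj_mul_specProj`), summing to `1` over the finite spectrum
(`sum_specProj`), `h = Σ k E_k` (`eq_sum_smul_specProj`), non-zero on the spectrum (`specProj_ne_zero`), commuting with the commutant of `h` (`commute_specProj`), self-adjoint;
**`cfc_eq_sum_specProj`**: `cfc f h = Σ_{k ∈ σ(h)} f(k) E_k(h)`.
HONEST FRAMING (page 1): elementary finite-dimensional spectral theory; nothing of Bałaban's; NOT (ACU), NOT NE7, NOT NE3; row NE7b NOT PRINTED ∕ NOT PROVED; spine 0∕9; finite T⁴ rung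
(B)+1 — NOT infinite volume, NOT mass gap, NOT BetaPertH, NOT Clay.
-/

set_option autoImplicit false

open scoped Matrix.Norms.L2Operator BigOperators
open Finset Polynomial

namespace Summit.QuantumFields.BalabanUV.T4Continuum.NE7SpectralResolution

noncomputable section

variable {n : Type} [Fintype n] [DecidableEq n]

/-! ## §1 The calculus of an orthogonal resolution -/

section Resolution

variable {ι : Type} [Fintype ι] [DecidableEq ι]

/-- Powers: `h^m = Σ k_j^m P_j`. [folklore] -/
theorem pow_eq_sum_of_resolution (P : ι → Matrix n n ℂ) (k : ι → ℝ)
    (horth : ∀ i j, P i * P j = if i = j then P i else 0) (hsum : ∑ j, P j = 1) (m : ℕ) :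
    (∑ j, ((k j : ℂ)) • P j) ^ m = ∑ j, ((k j : ℂ) ^ m) • P j := by
  induction m with
  | zero => simp [hsum]
  | succ m ih =>
      rw [pow_succ, ih, Finset.sum_mul_sum]
      have hterm : ∀ i j, ((k i : ℂ) ^ m • P i) * ((k j : ℂ) • P j) = if i = j then ((k i : ℂ) ^ (m + 1)) • P i else 0 := by
        intro i j
        rw [smul_mul_smul_comm, horth i j]
        split_ifs with hij
        · subst hij; rw [pow_succ]
        · rw [smul_zero]
      simp_rw [hterm]
      simp [Finset.sum_ite_eq]

/-- Polynomials: `q(h) = Σ q(k_j) P_j`. [folklore] -/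
theorem aeval_eq_sum_of_resolution (P : ι → Matrix n n ℂ) (k : ι → ℝ)
    (horth : ∀ i j, P i * P j = if i = j then P i else 0) (hsum : ∑ j, P j = 1) (q : ℝ[X]) :
    aeval (∑ j, ((k j : ℂ)) • P j) (q.map (algebraMap ℝ ℂ)) = ∑ j, ((q.eval (k j) : ℝ) : ℂ) • P j := by
  induction q using Polynomial.induction_on' with
  | add p q hp hq =>
      rw [Polynomial.map_add, map_add, hp, hq, ← Finset.sum_add_distrib]
      refine Finset.sum_congr rfl fun j _ => ?_
      rw [eval_add, Complex.ofReal_add, add_smul]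
  | monomial m r =>
      rw [Polynomial.map_monomial, aeval_monomial, pow_eq_sum_of_resolution P k horth hsum m, Finset.mul_sum]
      refine Finset.sum_congr rfl fun j _ => ?_
      rw [eval_monomial, Algebra.algebraMap_eq_smul_one, smul_mul_assoc, one_mul, smul_smul, Complex.ofReal_mul, Complex.ofReal_pow]
      rfl

/-- The real spectrum of `h = Σ k_j P_j` (self-adjoint) is contained in `{k_j : P_j ≠ 0}`: off those values `h − t` is inverted by `Σ (k_j − t)⁻¹ P_j`. [folklore] -/
theorem spectrum_subset_of_resolution (P : ι → Matrix n n ℂ) (k : ι → ℝ)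
    (horth : ∀ i j, P i * P j = if i = j then P i else 0) (hsum : ∑ j, P j = 1) {t : ℝ}
    (ht : t ∈ spectrum ℝ (∑ j, ((k j : ℂ)) • P j)) : ∃ j, P j ≠ 0 ∧ k j = t := by
  by_contra hne
  push Not at hne
  -- every `P_j ≠ 0` has `k_j ≠ t`; the explicit inverse
  have hkt : ∀ j, P j ≠ 0 → ((k j : ℂ) - t) ≠ 0 := by
    intro j hj h
    exact hne j hj (by exact_mod_cast (sub_eq_zero.mp h))
  set inv : Matrix n n ℂ := ∑ j, (((k j : ℂ) - t)⁻¹) • P j with hinv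
  have hdiff : (∑ j, ((k j : ℂ)) • P j) - (t : ℂ) • (1 : Matrix n n ℂ) = ∑ j, (((k j : ℂ) - t)) • P j := by
    rw [← hsum, Finset.smul_sum, ← Finset.sum_sub_distrib]
    refine Finset.sum_congr rfl fun j _ => ?_
    rw [sub_smul]
  have hprod : ∀ (u v : ι → ℂ), (∑ j, u j • P j) * (∑ j, v j • P j) = ∑ j, (u j * v j) • P j := by
    intro u v
    rw [Finset.sum_mul_sum]
    have hterm : ∀ i j, (u i • P i) * (v j • P j) = if i = j then (u i * v i) • P i else 0 := by
      intro i j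
      rw [smul_mul_smul_comm, horth i j]
      split_ifs with hij
      · subst hij; rfl
      · rw [smul_zero]
    simp_rw [hterm]
    simp [Finset.sum_ite_eq]
  have hone : ∑ j, ((((k j : ℂ) - t)) * (((k j : ℂ) - t)⁻¹)) • P j = 1 := by
    rw [← hsum]
    refine Finset.sum_congr rfl fun j _ => ?_
    by_cases hj : P j = 0
    · rw [hj, smul_zero]
    · rw [mul_inv_cancel₀ (hkt j hj), one_smul]
  have hone' : ∑ j, ((((k j : ℂ) - t)⁻¹) * (((k j : ℂ) - t))) • P j = 1 := by
    rw [← hone]; refine Finset.sum_congr rfl fun j _ => by rw [mul_comm]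
  have hunit : IsUnit ((∑ j, ((k j : ℂ)) • P j) - (t : ℂ) • (1 : Matrix n n ℂ)) := by
    rw [hdiff]
    refine ⟨⟨∑ j, (((k j : ℂ) - t)) • P j, inv, ?_, ?_⟩, rfl⟩
    · rw [hinv, hprod, hone]
    · rw [hinv, hprod, hone']
  -- contradiction with `t ∈ σ_ℝ`
  rw [spectrum.mem_iff] at ht
  apply ht
  have halg : (algebraMap ℝ (Matrix n n ℂ)) t = (t : ℂ) • (1 : Matrix n n ℂ) := by
    rw [Algebra.algebraMap_eq_smul_one]; rfl
  rw [halg]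
  have hneg : (t : ℂ) • (1 : Matrix n n ℂ) - ∑ j, ((k j : ℂ)) • P j = -((∑ j, ((k j : ℂ)) • P j) - (t : ℂ) • (1 : Matrix n n ℂ)) := by abel
  rw [hneg]
  exact hunit.neg

/-- Conversely every `k_j` with `P_j ≠ 0` is in the real spectrum. [folklore] -/
theorem mem_spectrum_of_resolution (P : ι → Matrix n n ℂ) (k : ι → ℝ)
    (horth : ∀ i j, P i * P j = if i = j then P i else 0) {j : ι} (hj : P j ≠ 0) :
    k j ∈ spectrum ℝ (∑ i, ((k i : ℂ)) • P i) := by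
  rw [spectrum.mem_iff]
  intro hunit
  apply hj
  obtain ⟨u, hu⟩ := hunit
  -- `(k_j − h) P_j = 0`, so `P_j = u⁻¹ (u P_j) = 0`
  have hkill : ((algebraMap ℝ (Matrix n n ℂ)) (k j) - ∑ i, ((k i : ℂ)) • P i) * P j = 0 := by
    rw [sub_mul, Finset.sum_mul]
    have hterm : ∀ i, ((k i : ℂ) • P i) * P j = if i = j then ((k j : ℂ)) • P j else 0 := by
      intro i
      rw [smul_mul_assoc, horth i j]
      split_ifs with hij
      · subst hij; rfl
      · rw [smul_zero]
    simp_rw [hterm]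
    simp only [Finset.sum_ite_eq', Finset.mem_univ, if_true]
    rw [Algebra.algebraMap_eq_smul_one, smul_mul_assoc, one_mul, sub_eq_zero]
    rfl
  rw [← hu] at hkill
  have h2 : (↑u⁻¹ : Matrix n n ℂ) * ((u : Matrix n n ℂ) * P j) = P j := by rw [← mul_assoc, Units.inv_mul, one_mul]
  rw [hkill, mul_zero] at h2
  exact h2.symm

/-- **THE FUNCTIONAL CALCULUS OF AN ORTHOGONAL RESOLUTION**: `cfc f h = Σ_j f(k_j) P_j` for every `f : ℝ → ℝ`, `h = Σ k_j P_j` self-adjoint. [folklore] -/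
theorem cfc_eq_sum_of_resolution (P : ι → Matrix n n ℂ) (k : ι → ℝ)
    (horth : ∀ i j, P i * P j = if i = j then P i else 0) (hsum : ∑ j, P j = 1) (hsa : IsSelfAdjoint (∑ j, ((k j : ℂ)) • P j))
    (f : ℝ → ℝ) : cfc f (∑ j, ((k j : ℂ)) • P j) = ∑ j, ((f (k j) : ℝ) : ℂ) • P j := by
  classical
  set h : Matrix n n ℂ := ∑ j, ((k j : ℂ)) • P j with hh
  -- Lagrange interpolation of `f` on the finite spectrum
  set S : Finset ℝ := (Matrix.finite_real_spectrum (A := h)).toFinset with hS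
  have hSmem : ∀ t, t ∈ S ↔ t ∈ spectrum ℝ h := fun t => by rw [hS, Set.Finite.mem_toFinset]
  set q : ℝ[X] := Lagrange.interpolate S id f with hq
  have hqS : ∀ t ∈ S, q.eval t = f t := by
    intro t ht
    have h1 := Lagrange.eval_interpolate_at_node (r := f) (v := id) (s := S) (Set.injOn_id _) ht
    simpa [hq] using h1
  have hcongr : cfc f h = cfc q.eval h := cfc_congr fun t ht => (hqS t ((hSmem t).mpr ht)).symm
  rw [hcongr, cfc_polynomial q h, hh]
  have haev : aeval (∑ j, ((k j : ℂ)) • P j) q = aeval (∑ j, ((k j : ℂ)) • P j) (q.map (algebraMap ℝ ℂ)) := by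
    rw [Polynomial.aeval_map_algebraMap]
  rw [haev, aeval_eq_sum_of_resolution P k horth hsum q]
  refine Finset.sum_congr rfl fun j _ => ?_
  by_cases hj : P j = 0
  · rw [hj, smul_zero, smul_zero]
  · rw [hqS (k j) ((hSmem _).mpr (mem_spectrum_of_resolution P k horth hj))]

end Resolution

/-! ## §2 Spectral projections of a self-adjoint matrix -/

/-- The indicator of a point is continuous on the (finite) real spectrum of a matrix. [folklore] -/
theorem continuousOn_ind_pt (h : Matrix n n ℂ) (k : ℝ) : ContinuousOn (fun t : ℝ => if t = k then (1 : ℝ) else 0) (spectrum ℝ h) :=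
  Set.Finite.continuousOn (Matrix.finite_real_spectrum (A := h)) _

/-- `E_k E_{k′} = δ_{kk′} E_k` for the spectral projections `E_k = cfc 𝟙_{{k}} h`. [folklore] -/
theorem specProj_mul_specProj (h : Matrix n n ℂ) (k k' : ℝ) :
    cfc (fun t : ℝ => if t = k then (1 : ℝ) else 0) h * cfc (fun t : ℝ => if t = k' then (1 : ℝ) else 0) h
      = if k = k' then cfc (fun t : ℝ => if t = k then (1 : ℝ) else 0) h else 0 := by
  rw [← cfc_mul _ _ h (continuousOn_ind_pt h k) (continuousOn_ind_pt h k')]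
  split_ifs with hkk
  · subst hkk
    congr 1; funext t; split_ifs <;> simp
  · have hz : (fun t : ℝ => (if t = k then (1 : ℝ) else 0) * (if t = k' then (1 : ℝ) else 0)) = 0 := by
      funext t
      by_cases h1 : t = k
      · subst h1; simp [hkk]
      · simp [h1]
    rw [hz, cfc_zero]

/-- `Σ_{k ∈ σ(h)} E_k = 1`. [folklore] -/
theorem sum_specProj (h : Matrix n n ℂ) (_hh : IsSelfAdjoint h) :
    ∑ k ∈ (Matrix.finite_real_spectrum (A := h)).toFinset, cfc (fun t : ℝ => if t = k then (1 : ℝ) else 0) h = 1 := by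
  rw [← cfc_sum (fun k => fun t : ℝ => if t = k then (1 : ℝ) else 0) h _ (fun k _ => continuousOn_ind_pt h k)]
  have hcongr : (spectrum ℝ h).EqOn (∑ k ∈ (Matrix.finite_real_spectrum (A := h)).toFinset, fun t : ℝ => if t = k then (1 : ℝ) else 0)
      (fun _ => 1) := by
    intro t ht
    simp only [Finset.sum_apply]
    rw [Finset.sum_ite_eq]
    simp [Set.Finite.mem_toFinset, ht]
  rw [cfc_congr hcongr, cfc_const_one ℝ h]

/-- `h = Σ_{k ∈ σ(h)} k E_k`. [folklore] -/
theorem eq_sum_smul_specProj (h : Matrix n n ℂ) (_hh : IsSelfAdjoint h) :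
    h = ∑ k ∈ (Matrix.finite_real_spectrum (A := h)).toFinset, ((k : ℝ) : ℂ) • cfc (fun t : ℝ => if t = k then (1 : ℝ) else 0) h := by
  have h1 : ∀ k : ℝ, ((k : ℝ) : ℂ) • cfc (fun t : ℝ => if t = k then (1 : ℝ) else 0) h = cfc (fun t : ℝ => k * (if t = k then (1 : ℝ) else 0)) h := by
    intro k
    rw [cfc_const_mul k _ h (continuousOn_ind_pt h k), Complex.coe_smul]
  simp_rw [h1]
  rw [← cfc_sum (fun k => fun t : ℝ => k * (if t = k then (1 : ℝ) else 0)) h _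
    (fun k _ => (continuousOn_const.mul (continuousOn_ind_pt h k)))]
  have hcongr : (spectrum ℝ h).EqOn (fun t : ℝ => t)
      (∑ k ∈ (Matrix.finite_real_spectrum (A := h)).toFinset, fun t : ℝ => k * (if t = k then (1 : ℝ) else 0)) := by
    intro t ht
    simp only [Finset.sum_apply, mul_ite, mul_one, mul_zero]
    rw [Finset.sum_ite_eq]
    simp [Set.Finite.mem_toFinset, ht]
  rw [← cfc_congr hcongr, cfc_id' ℝ h]

/-- `E_k ≠ 0` for `k ∈ σ(h)` (spectral mapping). [folklore] -/
theorem specProj_ne_zero [Nonempty n] (h : Matrix n n ℂ) (hh : IsSelfAdjoint h) {k : ℝ} (hk : k ∈ spectrum ℝ h) :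
    cfc (fun t : ℝ => if t = k then (1 : ℝ) else 0) h ≠ 0 := by
  intro hzero
  have hmap := cfc_map_spectrum (fun t : ℝ => if t = k then (1 : ℝ) else 0) h hh (continuousOn_ind_pt h k)
  rw [hzero, spectrum.zero_eq] at hmap
  have h1 : (1 : ℝ) ∈ (fun t : ℝ => if t = k then (1 : ℝ) else 0) '' spectrum ℝ h := ⟨k, hk, by simp⟩
  rw [← hmap] at h1
  exact one_ne_zero (Set.mem_singleton_iff.mp h1)

/-- Anything commuting with `h` commutes with every `E_k`. [folklore] -/
theorem commute_specProj {h z : Matrix n n ℂ} (hz : Commute z h) (k : ℝ) : Commute z (cfc (fun t : ℝ => if t = k then (1 : ℝ) else 0) h) :=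
  (hz.symm.cfc_real _).symm

/-- `E_k` is self-adjoint. [folklore] -/
theorem specProj_isSelfAdjoint (h : Matrix n n ℂ) (k : ℝ) : IsSelfAdjoint (cfc (fun t : ℝ => if t = k then (1 : ℝ) else 0) h) :=
  cfc_predicate _ h

/-- **THE FUNCTIONAL CALCULUS THROUGH THE SPECTRAL PROJECTIONS**: `cfc f h = Σ_{k ∈ σ(h)} f(k) E_k`. [folklore] -/
theorem cfc_eq_sum_specProj (h : Matrix n n ℂ) (_hh : IsSelfAdjoint h) (f : ℝ → ℝ) :
    cfc f h = ∑ k ∈ (Matrix.finite_real_spectrum (A := h)).toFinset, ((f k : ℝ) : ℂ) • cfc (fun t : ℝ => if t = k then (1 : ℝ) else 0) h := by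
  have h1 : ∀ k : ℝ, ((f k : ℝ) : ℂ) • cfc (fun t : ℝ => if t = k then (1 : ℝ) else 0) h = cfc (fun t : ℝ => f k * (if t = k then (1 : ℝ) else 0)) h := by
    intro k
    rw [cfc_const_mul (f k) _ h (continuousOn_ind_pt h k), Complex.coe_smul]
  simp_rw [h1]
  rw [← cfc_sum (fun k => fun t : ℝ => f k * (if t = k then (1 : ℝ) else 0)) h _
    (fun k _ => (continuousOn_const.mul (continuousOn_ind_pt h k)))]
  refine cfc_congr fun t ht => ?_
  simp only [Finset.sum_apply, mul_ite, mul_one, mul_zero]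
  rw [Finset.sum_ite_eq]
  simp [Set.Finite.mem_toFinset, ht]

end

end Summit.QuantumFields.BalabanUV.T4Continuum.NE7SpectralResolution
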